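import Summits.HubbardSuperconductivity.HubbardSuperconductivity.Theorems.AnisotropyChordTransferSectorZeroGround

/-!
# Route `AnisotropyChord` / H0 rotor rung, route (1): **THEOREM Z on GENERAL GRAPHS** — the theory seat's `SectorZeroGlobalGroundGraph`
# (PartE.lean, VERBATIM): for the spin-½ XXZ ferromagnet `−Σ_{xy∈E}(SˣSˣ + SʸSʸ + ΔSᶻSᶻ)` on any finite CONNECTED graph with an EVEN number of
# vertices and `|Δ| < 1`, the sector `Sᶻ_tot = 0` carries the ground energy: `E(0) ≤ E(M)` for every non-empty sector `M`.

Theory seat `hubbard-h0-rotor-theory-1`, THEOREM-Z.md / memo ROTOR-THEORY-11 §176 (bipartiteness NOT assumed; on bipartite graphs this is Mattis 1979 /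
Nishimori 1981, the general connected case is the VARIANT).  The torus case is `…TransferSectorZeroGround`; this file repeats the argument over an
arbitrary `SimpleGraph`:

* `xyzBondHamiltonianOn G n J₁ J₂ J₃ = −Σ_{e∈E(G)} (J₁ SˣSˣ + J₂ SʸSʸ + J₃ SᶻSᶻ)_e` (Björnberg–Ueltschi's three-coupling bond Hamiltonian on a graph;
  the tree's `xyzBondHamiltonian₃` is the torus case) with `xxzHamiltonian n G (−1) Δ = xyzBondHamiltonianOn G n 1 1 Δ`;
* the frame change on a graph (`exists_frame_xyzBondHamiltonianOn`, the Literature proof of `exists_frame_xyzBondHamiltonian₃` verbatim over `G.edgeFinset`):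
  `H'(J₁,J₂,J₃) ↦ H'(J₂,J₃,J₁)`, `Sˣ ↦ −Sᶻ ↦ Sʸ ↦ Sˣ`;
* spin-½ entries of `H'(J₁,J₂,J₃)` on a graph: stoquastic for `|J₂| ≤ J₁`, parity preserving, `−(J₁∓J₂)/4` on edge double flips; `⨂σʸ` fixes it;
* `exists_groundVector_sectorZero_graph` (the pinning lemma `exists_eigenvector_ker_of_flipParity` is graph-generic) and
  **`sectorZeroGlobalGroundGraph_holds : SectorZeroGlobalGroundGraph`**.

Prover seat `hubbard-h0-rotor-p1` g14.  All folklore / variant of Mattis 1979.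
-/

set_option linter.dupNamespace false
set_option autoImplicit false

noncomputable section

open Finset Matrix
open scoped ComplexOrder
open Literature.MathematicalPhysics.QuantumLattice Literature.MathematicalPhysics.QuantumLattice.SpinOperators

namespace Summit.HubbardSuperconductivity.HubbardSuperconductivity.Theorems.AnisotropyChord.Transfer

section Graph

variable {Λ : Type*} [Fintype Λ] [DecidableEq Λ] (G : SimpleGraph Λ) [DecidableRel G.Adj]

/-- **The three-coupling bond Hamiltonian `H'(J₁,J₂,J₃) = −Σ_{xy∈E(G)}(J₁ Sˣ_xSˣ_y + J₂ Sʸ_xSʸ_y + J₃ Sᶻ_xSᶻ_y)` on a finite graph** (Björnberg–Ueltschi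
(2.4); the tree's `xyzBondHamiltonian₃` is the case of the torus graph). [folklore] -/
def xyzBondHamiltonianOn (n : ℕ) (J₁ J₂ J₃ : ℝ) : Op Λ (n + 1) :=
  -∑ e ∈ G.edgeFinset, Sym2.lift ⟨fun x y => xyzBond₃ n J₁ J₂ J₃ x y, fun x y => (xyzBond₃_comm n J₁ J₂ J₃ y x)⟩ e

/-- `xxzHamiltonian n G (−1) Δ = H'(1, 1, Δ)`. [folklore] -/
theorem xxzHamiltonian_eq_xyzBondHamiltonianOn (n : ℕ) (Δ : ℝ) :
    xxzHamiltonian n G (-1) Δ = xyzBondHamiltonianOn G n 1 1 Δ := by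
  rw [xxzHamiltonian, xyzBondHamiltonianOn, Complex.ofReal_neg, Complex.ofReal_one, neg_one_smul]
  congr 1
  refine Finset.sum_congr rfl fun e _ => ?_
  induction e using Sym2.ind with
  | h x y => simp only [Sym2.lift_mk, xyzBond₃, Complex.ofReal_one, one_smul]

/-- Hermiticity of `H'(J₁,J₂,J₃)` on a graph. [folklore] -/
theorem xyzBondHamiltonianOn_isHermitian (n : ℕ) (J₁ J₂ J₃ : ℝ) : (xyzBondHamiltonianOn G n J₁ J₂ J₃).IsHermitian := by
  unfold xyzBondHamiltonianOn
  exact IsHermitian.neg (isHermitian_sum_lift _ _ fun x y => xyzBond₃_isHermitian n J₁ J₂ J₃ x y)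

omit [Fintype Λ] [DecidableEq Λ] [DecidableRel G.Adj] in
/-- adjacency from membership in the edge set. [folklore] -/
private theorem adj_of_mem_edgeFinset' [Fintype G.edgeSet] {x y : Λ} (h : s(x, y) ∈ G.edgeFinset) : G.Adj x y := by
  rwa [SimpleGraph.mem_edgeFinset, SimpleGraph.mem_edgeSet] at h

/-- **The frame change on a graph** (the Literature proof of `exists_frame_xyzBondHamiltonian₃`, verbatim over `G.edgeFinset`): a product unitary
with `Sˣ_x ↦ −Sᶻ_x`, `Sʸ_x ↦ Sˣ_x`, `Sᶻ_x ↦ −Sʸ_x` conjugates `H'(J₁,J₂,J₃)` into `H'(J₂,J₃,J₁)`. [cite: BjornbergUeltschi2022, Proposition 2.4] -/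
theorem exists_frame_xyzBondHamiltonianOn (n : ℕ) (J₁ J₂ J₃ : ℝ) :
    ∃ U : Op Λ (n + 1), U * Uᴴ = 1 ∧ Uᴴ * U = 1 ∧
      U * xyzBondHamiltonianOn G n J₁ J₂ J₃ * Uᴴ = xyzBondHamiltonianOn G n J₂ J₃ J₁ ∧
      (∀ x, U * siteSpin n x 0 * Uᴴ = -siteSpin n x 2) ∧
      (∀ x, U * siteSpin n x 1 * Uᴴ = siteSpin n x 0) ∧
      (∀ x, U * siteSpin n x 2 * Uᴴ = -siteSpin n x 1) := by
  obtain ⟨W, hW, hW', hWx, hWy, hWz⟩ := exists_unitary_cyclicAxes n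
  set U : Op Λ (n + 1) := productOp (fun _ : Λ => W) with hU
  have hu : ∀ z : Λ, (fun _ : Λ => W) z * ((fun _ : Λ => W) z)ᴴ = 1 := fun _ => hW
  have hu' : ∀ z : Λ, ((fun _ : Λ => W) z)ᴴ * (fun _ : Λ => W) z = 1 := fun _ => hW'
  have h0 : ∀ x : Λ, U * siteSpin n x 0 * Uᴴ = -siteSpin n x 2 := fun x => by
    rw [hU, productOp_conj_siteSpin hu, spinVec_zero, hWx, onSite_neg']
    rfl
  have h1 : ∀ x : Λ, U * siteSpin n x 1 * Uᴴ = siteSpin n x 0 := fun x => by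
    rw [hU, productOp_conj_siteSpin hu, spinVec_one, hWy]
    rfl
  have h2 : ∀ x : Λ, U * siteSpin n x 2 * Uᴴ = -siteSpin n x 1 := fun x => by
    rw [hU, productOp_conj_siteSpin hu, spinVec_two, hWz, onSite_neg']
    rfl
  have hb0 : ∀ x y : Λ, U * spinBond n 0 x y * Uᴴ = spinBond n 2 x y := fun x y => by
    rw [hU, productOp_conj_spinBond hu hu', spinVec_zero, hWx, onSite_neg', onSite_neg', neg_mul_neg,
      neg_mul_neg, spinBond]
    rfl
  have hb1 : ∀ x y : Λ, U * spinBond n 1 x y * Uᴴ = spinBond n 0 x y := fun x y => by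
    rw [hU, productOp_conj_spinBond hu hu', spinVec_one, hWy, spinBond]
    rfl
  have hb2 : ∀ x y : Λ, U * spinBond n 2 x y * Uᴴ = spinBond n 1 x y := fun x y => by
    rw [hU, productOp_conj_spinBond hu hu', spinVec_two, hWz, onSite_neg', onSite_neg', neg_mul_neg,
      neg_mul_neg, spinBond]
    rfl
  refine ⟨U, productOp_mul_conjTranspose hu, productOp_conjTranspose_mul hu', ?_, h0, h1, h2⟩
  rw [xyzBondHamiltonianOn, xyzBondHamiltonianOn, mul_neg, neg_mul, Finset.mul_sum, Finset.sum_mul]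
  congr 1
  refine Finset.sum_congr rfl fun e _ => ?_
  induction e using Sym2.ind with
  | h x y =>
    rw [Sym2.lift_mk, Sym2.lift_mk]
    show U * xyzBond₃ n J₁ J₂ J₃ x y * Uᴴ = xyzBond₃ n J₂ J₃ J₁ x y
    rw [xyzBond₃, xyzBond₃, mul_add, mul_add, add_mul, add_mul,
      mul_smul_comm, mul_smul_comm, mul_smul_comm, smul_mul_assoc, smul_mul_assoc, smul_mul_assoc,
      hb0, hb1, hb2]
    abel

/-- **`H'(J₁,J₂,J₃)` on a graph is stoquastic for `|J₂| ≤ J₁`**: real entries, non-positive off the diagonal. [cite: BjornbergUeltschi2022, Lemma A.1 (proof)] -/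
theorem xyzBondHamiltonianOn_apply (n : ℕ) (J₁ J₂ J₃ : ℝ) (hJ : -J₂ ≤ J₁) (hJ' : J₂ ≤ J₁) (σ τ : TensorIndex Λ (n + 1)) :
    (xyzBondHamiltonianOn G n J₁ J₂ J₃ σ τ).im = 0 ∧ (σ ≠ τ → (xyzBondHamiltonianOn G n J₁ J₂ J₃ σ τ).re ≤ 0) := by
  have key : ∀ e ∈ G.edgeFinset, ∃ t : ℝ,
      (Sym2.lift ⟨fun x y => xyzBond₃ n J₁ J₂ J₃ x y, fun x y => (xyzBond₃_comm n J₁ J₂ J₃ y x)⟩ e) σ τ = (t : ℂ) ∧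
        (σ ≠ τ → 0 ≤ t) := by
    intro e he
    induction e using Sym2.ind with
    | h x y =>
      obtain ⟨t, ht, ht'⟩ := xyzBond₃_apply n J₁ J₂ J₃ (adj_of_mem_edgeFinset' G he).ne σ τ
      exact ⟨t, by rw [Sym2.lift_mk]; exact ht, fun h => ht' h hJ hJ'⟩
  choose! t ht ht' using key
  have hsum : xyzBondHamiltonianOn G n J₁ J₂ J₃ σ τ = -∑ e ∈ G.edgeFinset, (t e : ℂ) := by
    rw [xyzBondHamiltonianOn, Matrix.neg_apply, Matrix.sum_apply]
    congr 1
    exact Finset.sum_congr rfl fun e he => ht e he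
  constructor
  · rw [hsum, Complex.neg_im, Complex.im_sum]
    simp
  · intro hστ
    rw [hsum, Complex.neg_re, Complex.re_sum, neg_nonpos]
    exact Finset.sum_nonneg fun e he => by simpa using ht' e he hστ

/-- real, symmetric, non-positive off-diagonal entries of `H'(J₁,J₂,J₃)` on a graph (`|J₂| ≤ J₁`). [folklore] -/
theorem xyzBondHamiltonianOn_entries (n : ℕ) (J₁ J₂ J₃ : ℝ) (hJ : -J₂ ≤ J₁) (hJ' : J₂ ≤ J₁) :
    (∀ σ τ : TensorIndex Λ (n + 1), star (xyzBondHamiltonianOn G n J₁ J₂ J₃ σ τ) = xyzBondHamiltonianOn G n J₁ J₂ J₃ σ τ) ∧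
    (∀ σ τ : TensorIndex Λ (n + 1), xyzBondHamiltonianOn G n J₁ J₂ J₃ σ τ = xyzBondHamiltonianOn G n J₁ J₂ J₃ τ σ) ∧
    (∀ σ τ : TensorIndex Λ (n + 1), σ ≠ τ → (xyzBondHamiltonianOn G n J₁ J₂ J₃ σ τ).re ≤ 0) := by
  have hreal : ∀ σ τ : TensorIndex Λ (n + 1),
      star (xyzBondHamiltonianOn G n J₁ J₂ J₃ σ τ) = xyzBondHamiltonianOn G n J₁ J₂ J₃ σ τ :=
    fun σ τ => Complex.conj_eq_iff_im.2 (xyzBondHamiltonianOn_apply G n J₁ J₂ J₃ hJ hJ' σ τ).1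
  refine ⟨hreal, fun σ τ => ?_, fun σ τ hστ => (xyzBondHamiltonianOn_apply G n J₁ J₂ J₃ hJ hJ' σ τ).2 hστ⟩
  have h := (xyzBondHamiltonianOn_isHermitian G n J₁ J₂ J₃).apply τ σ
  rw [hreal] at h
  exact h

/-- **off-diagonal matrix elements of the spin-½ `H'(J₁,J₂,J₃)` on a graph vanish off the edge double flips.** [folklore] -/
theorem xyzBondHamiltonianOn_one_apply_eq_zero (J₁ J₂ J₃ : ℝ) {σ τ : TensorIndex Λ 2} (hστ : σ ≠ τ)
    (h : ∀ x y : Λ, G.Adj x y → τ ≠ flipAt x (flipAt y σ)) : xyzBondHamiltonianOn G 1 J₁ J₂ J₃ σ τ = 0 := by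
  rw [xyzBondHamiltonianOn, Matrix.neg_apply, Matrix.sum_apply, neg_eq_zero]
  refine Finset.sum_eq_zero fun e he => ?_
  induction e using Sym2.ind with
  | h x y =>
    have hadj := adj_of_mem_edgeFinset' G he
    rw [Sym2.lift_mk]
    show xyzBond₃ 1 J₁ J₂ J₃ x y σ τ = 0
    rw [xyzBond₃_one_apply_of_ne J₁ J₂ J₃ hadj.ne hστ, if_neg (h x y hadj)]

/-- **matrix element of the spin-½ `H'(J₁,J₂,J₃)` on an edge double flip of a graph**: `−(J₁ ∓ J₂)/4`. [folklore] -/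
theorem xyzBondHamiltonianOn_one_apply_doubleFlip (J₁ J₂ J₃ : ℝ) {x y : Λ} (hxy : G.Adj x y) (σ : TensorIndex Λ 2) :
    xyzBondHamiltonianOn G 1 J₁ J₂ J₃ σ (flipAt x (flipAt y σ)) = -(((J₁ - (if σ x = σ y then J₂ else -J₂)) / 4 : ℝ) : ℂ) := by
  have hne : x ≠ y := hxy.ne
  have hστ : σ ≠ flipAt x (flipAt y σ) := by
    intro h
    have := congrFun h x
    rw [flipAt_apply_self, flipAt_apply_of_ne _ hne] at this
    revert this
    rcases Fin.exists_fin_two.mp ⟨σ x, rfl⟩ with h0 | h0 <;> rw [h0] <;> decide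
  rw [xyzBondHamiltonianOn, Matrix.neg_apply, Matrix.sum_apply]
  congr 1
  rw [Finset.sum_eq_single (s(x, y))]
  · rw [Sym2.lift_mk]
    show xyzBond₃ 1 J₁ J₂ J₃ x y σ (flipAt x (flipAt y σ)) = _
    rw [xyzBond₃_one_apply_of_ne J₁ J₂ J₃ hne hστ, if_pos rfl]
  · intro e he hexy
    induction e using Sym2.ind with
    | h x' y' =>
      have hadj := adj_of_mem_edgeFinset' G he
      rw [Sym2.lift_mk]
      show xyzBond₃ 1 J₁ J₂ J₃ x' y' σ (flipAt x (flipAt y σ)) = 0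
      rw [xyzBond₃_one_apply_of_ne J₁ J₂ J₃ hadj.ne hστ, if_neg]
      intro h
      exact hexy (sym2_eq_of_flipAt_flipAt_eq hne σ h).symm
  · intro h
    exact absurd ((SimpleGraph.mem_edgeFinset).2 hxy) h

/-- **`H'(J₁,J₂,J₃)` (spin ½) on a graph preserves the parity of `Σ_z σ_z`.** [folklore] -/
theorem xyzBondHamiltonianOn_one_apply_of_parity_ne (J₁ J₂ J₃ : ℝ) {σ τ : TensorIndex Λ 2}
    (h : (∑ z, (σ z : ℕ)) % 2 ≠ (∑ z, (τ z : ℕ)) % 2) : xyzBondHamiltonianOn G 1 J₁ J₂ J₃ σ τ = 0 := by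
  have hστ : σ ≠ τ := fun h' => h (by rw [h'])
  refine xyzBondHamiltonianOn_one_apply_eq_zero G J₁ J₂ J₃ hστ fun x y _ hτ => h ?_
  rw [hτ, weight_flipAt_flipAt_mod_two]

/-- **`⨂σʸ` commutes with the spin-½ `H'(J₁,J₂,J₃)` on a graph.** [folklore] -/
theorem flipOp_conj_xyzBondHamiltonianOn (J₁ J₂ J₃ : ℝ) :
    productOp (fun _ : Λ => spinHalfPauli 1) * xyzBondHamiltonianOn G 1 J₁ J₂ J₃ * (productOp (fun _ : Λ => spinHalfPauli 1))ᴴ =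
      xyzBondHamiltonianOn G 1 J₁ J₂ J₃ := by
  set U := productOp (fun _ : Λ => spinHalfPauli 1) with hU
  rw [xyzBondHamiltonianOn, mul_neg, neg_mul, Finset.mul_sum, Finset.sum_mul]
  congr 1
  refine Finset.sum_congr rfl fun e _ => ?_
  induction e using Sym2.ind with
  | h x y =>
    rw [Sym2.lift_mk]
    show U * xyzBond₃ 1 J₁ J₂ J₃ x y * Uᴴ = xyzBond₃ 1 J₁ J₂ J₃ x y
    rw [xyzBond₃, mul_add, mul_add, add_mul, add_mul, mul_smul_comm, mul_smul_comm, mul_smul_comm,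
      smul_mul_assoc, smul_mul_assoc, smul_mul_assoc, hU, flipOp_conj_spinBond, flipOp_conj_spinBond,
      flipOp_conj_spinBond]

/-- **THEOREM Z on a graph: a ground vector in `Sᶻ_tot = 0`.**  For a connected graph with `2m` vertices and `|Δ| < 1`, the XXZ ferromagnet
`xxzHamiltonian 1 G (−1) Δ` has a ground vector (at the bottom `E₀` of its Rayleigh quotient) annihilated by `Sᶻ_tot`. [folklore] -/
theorem exists_groundVector_sectorZero_graph (hG : G.Connected) {m : ℕ} (hm : Fintype.card Λ = 2 * m) {Δ : ℝ} (hΔ : |Δ| < 1) :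
    ∃ u : TensorIndex Λ 2 → ℂ, u ≠ 0 ∧
      (∀ v : TensorIndex Λ 2 → ℂ,
        (xxzHamiltonian 1 G (-1) Δ).minEnergyOn ⊤ * (star v ⬝ᵥ v).re ≤ (star v ⬝ᵥ xxzHamiltonian 1 G (-1) Δ *ᵥ v).re) ∧
      xxzHamiltonian 1 G (-1) Δ *ᵥ u = (((xxzHamiltonian 1 G (-1) Δ).minEnergyOn ⊤ : ℝ) : ℂ) • u ∧
      (totalSpin 1 2 : Op Λ 2) *ᵥ u = 0 := by
  have hne : Nonempty Λ := hG.nonempty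
  obtain ⟨x₀⟩ := hne
  set H : Op Λ 2 := xxzHamiltonian 1 G (-1) Δ with hHdef
  have hH : H.IsHermitian := xxzHamiltonian_isHermitian 1 G (-1) Δ
  set E₀ : ℝ := H.minEnergyOn ⊤ with hE₀
  have htop : (⊤ : Submodule ℂ (TensorIndex Λ 2 → ℂ)) ≠ ⊥ := by
    intro h
    have hmem : (fun _ => (1 : ℂ)) ∈ (⊤ : Submodule ℂ (TensorIndex Λ 2 → ℂ)) := Submodule.mem_top
    rw [h, Submodule.mem_bot] at hmem
    exact one_ne_zero (congrFun hmem (fun _ => 0))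
  obtain ⟨v₀, -, hv₀1, hHv₀⟩ := exists_unit_eigen_minEnergyOn hH ⊤ (fun v _ => Submodule.mem_top) htop
  have hv₀ : v₀ ≠ 0 := by
    intro h; rw [h, dotProduct_zero] at hv₀1; exact zero_ne_one hv₀1
  have hE : ∀ v : TensorIndex Λ 2 → ℂ, E₀ * (star v ⬝ᵥ v).re ≤ (star v ⬝ᵥ H *ᵥ v).re :=
    fun v => minEnergyOn_mul_le_re_rayleigh hH ⊤ Submodule.mem_top
  -- the frame and the rotated operators
  obtain ⟨U, hU, hU', hUH, hUx, hUy, hUz⟩ := exists_frame_xyzBondHamiltonianOn G 1 1 1 Δ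
  rw [← xxzHamiltonian_eq_xyzBondHamiltonianOn] at hUH
  set Ht := xyzBondHamiltonianOn G 1 1 Δ 1 with hHt
  set Y : Op Λ 2 := totalSpin 1 1 with hY
  set Gt : Op Λ 2 := productOp (fun _ : Λ => spinHalfPauli 1) with hGt
  have hΔ1 : -Δ ≤ 1 := by have := (abs_lt.1 hΔ).1; linarith
  have hΔ2 : Δ ≤ 1 := (abs_lt.1 hΔ).2.le
  obtain ⟨hreal, hsymm, hoff⟩ := xyzBondHamiltonianOn_entries G 1 1 Δ 1 hΔ1 hΔ2
  obtain ⟨hGG, hGG'⟩ := flipOp_mul_conjTranspose (Λ := Λ)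
  have hHG : Ht * Gt = Gt * Ht := by
    have h := flipOp_conj_xyzBondHamiltonianOn G 1 Δ 1
    calc Ht * Gt = Gt * Ht * Gtᴴ * Gt := by rw [h]
      _ = Gt * Ht := by rw [Matrix.mul_assoc, hGG', Matrix.mul_one]
  have hYG : Y * Gt = Gt * Y := by
    have h := flipOp_conj_totalSpin_one (Λ := Λ)
    calc Y * Gt = Gt * Y * Gtᴴ * Gt := by rw [h]
      _ = Gt * Y := by rw [Matrix.mul_assoc, hGG', Matrix.mul_one]
  have hSz : U * (totalSpin 1 2 : Op Λ 2) * Uᴴ = -Y := by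
    rw [hY, totalSpin, totalSpin, Finset.mul_sum, Finset.sum_mul, ← Finset.sum_neg_distrib]
    exact Finset.sum_congr rfl fun x _ => hUz x
  have hcomm := (HardCoreBoson.commute_xxzHamiltonian_totalSpin_two 1 G (-1) Δ).eq
  have hHY : Ht * Y = Y * Ht := by
    have h1 : Ht = U * H * Uᴴ := hUH.symm
    have h2 : Y = -(U * (totalSpin 1 2 : Op Λ 2) * Uᴴ) := by rw [hSz, neg_neg]
    rw [h1, h2, mul_neg, neg_mul, conj_mul_conj hU' _ _, conj_mul_conj hU' _ _, hcomm]
  have hflip : ∀ (x y : Λ) (σ : TensorIndex Λ 2), G.Adj x y → Ht σ (flipAt x (flipAt y σ)) ≠ 0 := by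
    intro x y σ hxy
    rw [hHt, xyzBondHamiltonianOn_one_apply_doubleFlip G 1 Δ 1 hxy σ, neg_ne_zero, Complex.ofReal_ne_zero]
    have h1 := (abs_lt.1 hΔ).1
    have h2 := (abs_lt.1 hΔ).2
    split_ifs <;> · intro h; linarith
  -- rotate, pin, rotate back
  have hEt : ∀ v : TensorIndex Λ 2 → ℂ, E₀ * (star v ⬝ᵥ v).re ≤ (star v ⬝ᵥ Ht *ᵥ v).re := by
    intro v
    rw [← hUH, star_dotProduct_conj_mulVec, ← star_dotProduct_conjTranspose_mulVec hU v]
    exact hE _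
  have hv₀t : U *ᵥ v₀ ≠ 0 := mulVec_ne_zero_of_left_inverse hU' hv₀
  have hHv₀t : Ht *ᵥ (U *ᵥ v₀) = (E₀ : ℂ) • (U *ᵥ v₀) := by
    rw [← hUH, conj_mulVec_mulVec hU', hHv₀, Matrix.mulVec_smul]
  obtain ⟨w, hw0, hHw, hYw⟩ := exists_eigenvector_ker_of_flipParity G hG hm Ht Y Gt hreal hsymm hoff
    (fun σ τ h => xyzBondHamiltonianOn_one_apply_of_parity_ne G 1 Δ 1 h) hflip hHY hHG hYG
    (fun σ τ h => totalSpin_one_one_apply_of_parity_eq h) (flipOp_mulVec_of_even hm) hEt hv₀t hHv₀t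
  refine ⟨Uᴴ *ᵥ w, mulVec_ne_zero_of_left_inverse (U := Uᴴ) (V := U) hU hw0, hE, ?_, ?_⟩
  · have hHU : H = Uᴴ * Ht * U := by
      rw [← hUH]
      calc H = (Uᴴ * U) * H * (Uᴴ * U) := by rw [hU', Matrix.one_mul, Matrix.mul_one]
        _ = Uᴴ * (U * H * Uᴴ) * U := by simp only [Matrix.mul_assoc]
    rw [hHU, Matrix.mulVec_mulVec, Matrix.mul_assoc, Matrix.mul_assoc, hU, Matrix.mul_one, ← Matrix.mulVec_mulVec, hHw,
      Matrix.mulVec_smul]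
  · have hSzU : (totalSpin 1 2 : Op Λ 2) = -(Uᴴ * Y * U) := by
      calc (totalSpin 1 2 : Op Λ 2) = (Uᴴ * U) * totalSpin 1 2 * (Uᴴ * U) := by rw [hU', Matrix.one_mul, Matrix.mul_one]
        _ = Uᴴ * (U * totalSpin 1 2 * Uᴴ) * U := by simp only [Matrix.mul_assoc]
        _ = -(Uᴴ * Y * U) := by rw [hSz, Matrix.mul_neg, Matrix.neg_mul, Matrix.mul_assoc]
    rw [hSzU, Matrix.neg_mulVec, Matrix.mulVec_mulVec, Matrix.mul_assoc, Matrix.mul_assoc, hU, Matrix.mul_one,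
      ← Matrix.mulVec_mulVec, hYw, Matrix.mulVec_zero, neg_zero]

/-- **THEOREM Z on a graph: `E(0) ≤ E(M)` for every non-empty sector** (connected graph, even number of vertices, `|Δ| < 1`). [folklore] -/
theorem lowestEnergyInSector_zero_le_graph (hG : G.Connected) (hV : Even (Fintype.card Λ)) {Δ : ℝ} (hΔ : |Δ| < 1) (M : ℝ)
    (hM : spinZSector (Λ := Λ) 1 M ≠ ⊥) :
    lowestEnergyInSector 1 (xxzHamiltonian 1 G (-1) Δ) 0 ≤ lowestEnergyInSector 1 (xxzHamiltonian 1 G (-1) Δ) M := by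
  obtain ⟨m, hm'⟩ := hV
  have hm : Fintype.card Λ = 2 * m := by rw [hm']; ring
  obtain ⟨u, hu0, hE, hHu, hSzu⟩ := exists_groundVector_sectorZero_graph G hG hm hΔ
  set H : Op Λ 2 := xxzHamiltonian 1 G (-1) Δ with hHdef
  have hH : H.IsHermitian := xxzHamiltonian_isHermitian 1 G (-1) Δ
  set E₀ : ℝ := H.minEnergyOn ⊤ with hE₀
  -- `E(0) ≤ E₀`
  have humem : u ∈ spinZSector (Λ := Λ) 1 (0 : ℝ) := by
    rw [spinZSector, Module.End.mem_eigenspace_iff, Matrix.toLin'_apply, hSzu, Complex.ofReal_zero, zero_smul]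
  have h0 : lowestEnergyInSector 1 H 0 ≤ E₀ := by
    have h := minEnergyOn_mul_le_re_rayleigh hH (spinZSector (Λ := Λ) 1 (0 : ℝ)) humem
    rw [hHu, dotProduct_smul, smul_eq_mul, Complex.re_ofReal_mul] at h
    exact le_of_mul_le_mul_right h (EigenvalueContinuation.re_star_dotProduct_self_pos hu0)
  -- `E₀ ≤ E(M)` for a non-empty sector
  have h1 : E₀ ≤ lowestEnergyInSector 1 H M := by
    obtain ⟨w, hwK, hw0⟩ := Submodule.exists_mem_ne_zero_of_ne_bot hM
    obtain ⟨c, -, hc1⟩ := exists_smul_unit hw0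
    unfold lowestEnergyInSector Matrix.minEnergyOn
    refine le_csInf ⟨_, c • w, (spinZSector (Λ := Λ) 1 M).smul_mem c hwK, hc1, rfl⟩ ?_
    rintro E ⟨ψ, -, hψ1, rfl⟩
    have h := hE ψ
    rw [hψ1, Complex.one_re, mul_one] at h
    exact h
  exact h0.trans h1

end Graph

/-! ## The theory seat's general-graph target -/

/-- **THEOREM Z on general graphs** (VERBATIM port of the theory seat's `SectorZeroGlobalGroundGraph`, PartE.lean): for the spin-½ XXZ ferromagnet
`xxzHamiltonian 1 G (−1) Δ` on a finite CONNECTED graph with an EVEN number of vertices and `|Δ| < 1`, `E(0) ≤ E(M)` for every non-empty sector `M`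
(bipartiteness is not assumed).
[conjecture: theory seat hubbard-h0-rotor-theory-1, cycle 12, memo ROTOR-THEORY-11 §176 — THEOREM Z, PROVED on paper; Lean proof below] -/
def SectorZeroGlobalGroundGraph : Prop :=
  ∀ (V : Type) [Fintype V] [DecidableEq V] (G : SimpleGraph V) [DecidableRel G.Adj] (Δ M : ℝ),
    |Δ| < 1 → G.Connected → Even (Fintype.card V) →
    spinZSector (Λ := V) 1 M ≠ ⊥ →
      lowestEnergyInSector 1 (xxzHamiltonian 1 G (-1) Δ) 0
        ≤ lowestEnergyInSector 1 (xxzHamiltonian 1 G (-1) Δ) M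

/-- **THEOREM Z HOLDS on every finite connected graph with an even number of vertices, `|Δ| < 1`** (Mattis 1979 / Nishimori 1981 on bipartite
graphs; the general connected case is the theory seat's variant, THEOREM-Z.md). [folklore] -/
theorem sectorZeroGlobalGroundGraph_holds : SectorZeroGlobalGroundGraph :=
  fun _ _ _ G _ _ M hΔ hG hV hM => lowestEnergyInSector_zero_le_graph G hG hV hΔ M hM

end Summit.HubbardSuperconductivity.HubbardSuperconductivity.Theorems.AnisotropyChord.Transfer
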